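import Literature.ModelTheory.ExponentialFields.OMinimalDefinableChoice
import Literature.ModelTheory.ExponentialFields.RealClosedFieldTheoryProofs
import Literature.ModelTheory.ExponentialFields.RealExpFieldProofs
import Literature.ModelTheory.ExponentialFields.DefinabilityParams
import Literature.ModelTheory.ExponentialFields.OMinimalIntervals
import HarnessLib

/-!
# Definable choice for `ℚ`-semialgebraic sets — van den Dries 1998, Ch. 6 (1.1)–(1.2)(i)
# (proof file)

Discharge of the named fact
`Literature.ModelTheory.ExponentialFields.vandenDries1998_ch6_prop_1_2_i`
(`OMinimalDefinableChoice.lean`; L. van den Dries, *Tame Topology and O-minimal Structures*, LMS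
Lecture Note Series 248, CUP 1998, Ch. 6, §1, Proposition (1.2)(i), p. 94, for the o-minimal
structure `(ℝ, <, 0, 1, +, -, ·)` and parameter-free (= `ℚ`-semialgebraic) data): the theorem
`vandenDries1998_ch6_prop_1_2_i_holds` below has literally the type of the fact; its axioms are
the three standard ones.

## Proof architecture (van den Dries 1998, Ch. 6, (1.1)–(1.2), followed as printed)

* **(1.1)(i), the canonical point `e(X)` of a nonempty definable `X ⊆ ℝ`**
  (`DefinableChoice.canonicalPt`): the least element of `X` if there is one; otherwise, with
  `(a, b)` the "left-most interval" of `X` (`a = inf X`, `b = sup {t | (a, t) ⊆ X}`), the point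
  `0`, `b - 1`, `a + 1` or `(a + b) / 2` according as `a = -∞` or not, `b = +∞` or not. That
  `a < b` and `(a, b) ⊆ X` ("Then `a < b` and `(a, b) ⊆ X`") is where tameness enters: for a
  finite union of points and intervals the right germ at `inf X` is constant and a set unbounded
  below contains a ray (`DefinableChoice.exists_Ioo_sInf_subset`,
  `DefinableChoice.exists_Iio_subset`, from `OMinimalIntervals.lean`); hence `e(X) ∈ X`
  (`DefinableChoice.canonicalPt_mem`).
* **"definably pick"**: the case distinction is a first-order condition
  `DefinableChoice.IsCanonicalPt X y` in the language `(<, +, 0, 1)` (least element, `IsGLB`,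
  `IsLUB`, unboundedness), which characterises `y = e(X)` (`DefinableChoice.eq_canonicalPt_iff`)
  and is definable uniformly in parameters (`DefinableChoice.UDef.isCanonicalPt`, assembled from
  the definability kit `DefinabilityParams.lean`; `DefinableChoice.UDef` packages "uniformly
  definable family of subsets of the line" so that nested quantifiers compose).
* **(1.2)(i) for `n = 1`** (`DefinableChoice.exists_choice_last`): for `ℚ`-semialgebraic
  `V ⊆ ℝ^(N+1)`, `h(w) := e(V_w)`; the fibres `V_w` are finite unions of intervals by
  o-minimality of the real field (`real_isOMinimal_holds`, van den Dries Ch. 2, (2.11)), and the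
  graph of `h` over `π V` is definable over `ℚ`, i.e. `ℚ`-semialgebraic
  (`definable_iff_isSemialgebraic_real_holds`, Tarski–Seidenberg).
* **(1.2)(i) in general** (`DefinableChoice.exists_choice`): induction on `n` as in (1.1)(ii)
  (`e(X) := (a, e(X_a))`, `a = e(π X)`): project `V ⊆ ℝ^(p+(q+1))` to `W ⊆ ℝ^(p+q)`
  (semialgebraic by Tarski–Seidenberg, `tarski_seidenberg_real_holds`), choose `g₀` for `W`
  inductively and the last coordinate over `W` by the case `n = 1`.

## References

* [Dries1998] L. van den Dries, *Tame Topology and O-minimal Structures*, LMS Lecture Note Series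
  248, Cambridge University Press (1998), Ch. 6, §1, (1.1)–(1.3), pp. 93–94; Ch. 1, (3.3);
  Ch. 2, (2.11).
* [BochnakCosteRoy1998] J. Bochnak, M. Coste, M.-F. Roy, *Real Algebraic Geometry*, Springer
  (1998), Thm. 2.2.1 (Tarski–Seidenberg).
-/

noncomputable section

open Set FirstOrder FirstOrder.Language

namespace Literature.ModelTheory.ExponentialFields

namespace DefinableChoice

/-! ### (1.1)(i): the canonical point `e(X)` of a nonempty definable `X ⊆ ℝ` -/

/-- **van den Dries 1998, Ch. 6, (1.1)(i), as a first-order condition.** `IsCanonicalPt X y`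
transcribes the printed case distinction defining `e(X)`: either `y` is the least element of `X`;
or `X` has no least element and, with `a = inf X ∈ ℝ ∪ {-∞}` and
`b = sup {t | (a, t) ⊆ X} ∈ ℝ ∪ {+∞}` (the "left-most interval" `(a, b)` of `X`),
`y = (a + b) / 2`, `a + 1`, `b - 1` or `0` according as `a`, `b` are finite or not. Written with
`IsGLB` / `IsLUB` / `¬ BddBelow` / `¬ BddAbove` so that it is visibly first-order in the ordered
group language (whence definability, `UDef.isCanonicalPt`) and pins `y` down uniquely
(`IsCanonicalPt.unique`). [cite: Dries1998, Ch. 6 §1 (1.1)(i), p. 93] -/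
def IsCanonicalPt (X : Set ℝ) (y : ℝ) : Prop :=
  IsLeast X y ∨
    ((¬ ∃ m, IsLeast X m) ∧
      ((∃ a, IsGLB X a ∧
          ((∃ b, IsLUB {t | a < t ∧ Ioo a t ⊆ X} b ∧ y + y = a + b) ∨
            (¬ BddAbove {t | a < t ∧ Ioo a t ⊆ X} ∧ y = a + 1))) ∨
        (¬ BddBelow X ∧
          ((∃ b, IsLUB {t | Iio t ⊆ X} b ∧ y + 1 = b) ∨
            (¬ BddAbove {t | Iio t ⊆ X} ∧ y = 0)))))

open Classical in
/-- **The canonical point `e(X)`** of van den Dries 1998, Ch. 6, (1.1)(i): the least element of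
`X` if there is one; otherwise, with `(a, b)` the left-most interval of `X` (`a = inf X`,
`b = sup {t | (a, t) ⊆ X}`), `e(X) := 0` if `a = -∞, b = +∞`; `b - 1` if `a = -∞, b ∈ ℝ`; `a + 1`
if `a ∈ ℝ, b = +∞`; `(a + b) / 2` if `a, b ∈ ℝ`. (Values on sets that are not nonempty finite
unions of intervals are junk.) [cite: Dries1998, Ch. 6 §1 (1.1)(i), p. 93] -/
def canonicalPt (X : Set ℝ) : ℝ :=
  if h : ∃ m, IsLeast X m then h.choose
  else if BddBelow X then
    (if BddAbove {t | sInf X < t ∧ Ioo (sInf X) t ⊆ X}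
      then (sInf X + sSup {t | sInf X < t ∧ Ioo (sInf X) t ⊆ X}) / 2
      else sInf X + 1)
  else if BddAbove {t | Iio t ⊆ X} then sSup {t | Iio t ⊆ X} - 1 else 0

/-- A point satisfying the first-order description of `e(X)` lies in `X` ("we can definably pick
an element `e(X) ∈ X`", van den Dries 1998, Ch. 6, (1.1)): in each case the chosen point lies in
the left-most interval `(a, b) ⊆ X`. Pure order bookkeeping over `ℝ`, no tameness needed.
[cite: Dries1998, Ch. 6 §1 (1.1)(i), p. 93] -/
theorem IsCanonicalPt.mem {X : Set ℝ} {y : ℝ} (h : IsCanonicalPt X y) : y ∈ X := by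
  rcases h with hl | ⟨-, ⟨a, -, ⟨b, hb, hy⟩ | ⟨hb, hy⟩⟩ | ⟨-, ⟨b, hb, hy⟩ | ⟨hb, hy⟩⟩⟩
  · exact hl.1
  · obtain ⟨t, ht⟩ := hb.nonempty
    have htb : t ≤ b := hb.1 ht
    have hat : a < t := ht.1
    obtain ⟨c, hc, hyc, -⟩ := hb.exists_between (show y < b by linarith)
    exact hc.2 ⟨by linarith [hc.1], hyc⟩
  · obtain ⟨t, ht, hyt⟩ := not_bddAbove_iff.1 hb y
    exact ht.2 ⟨by linarith [ht.1], hyt⟩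
  · obtain ⟨c, hc, hyc, -⟩ := hb.exists_between (show y < b by linarith)
    exact hc hyc
  · obtain ⟨t, ht, hyt⟩ := not_bddAbove_iff.1 hb y
    exact ht hyt

/-- The first-order description of `e(X)` has at most one solution: least elements, infima and
suprema are unique, and the cases are mutually exclusive.
[cite: Dries1998, Ch. 6 §1 (1.1)(i), p. 93] -/
theorem IsCanonicalPt.unique {X : Set ℝ} {y₁ y₂ : ℝ} (h₁ : IsCanonicalPt X y₁)
    (h₂ : IsCanonicalPt X y₂) : y₁ = y₂ := by
  rcases h₁ with hl₁ | ⟨hn₁, h₁⟩ <;> rcases h₂ with hl₂ | ⟨hn₂, h₂⟩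
  · exact hl₁.unique hl₂
  · exact (hn₂ ⟨y₁, hl₁⟩).elim
  · exact (hn₁ ⟨y₂, hl₂⟩).elim
  rcases h₁ with ⟨a₁, hg₁, h₁⟩ | ⟨hu₁, h₁⟩ <;> rcases h₂ with ⟨a₂, hg₂, h₂⟩ | ⟨hu₂, h₂⟩
  · obtain rfl : a₁ = a₂ := hg₁.unique hg₂
    rcases h₁ with ⟨b₁, hb₁, hy₁⟩ | ⟨hv₁, hy₁⟩ <;> rcases h₂ with ⟨b₂, hb₂, hy₂⟩ | ⟨hv₂, hy₂⟩
    · obtain rfl : b₁ = b₂ := hb₁.unique hb₂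
      linarith
    · exact (hv₂ hb₁.bddAbove).elim
    · exact (hv₁ hb₂.bddAbove).elim
    · linarith
  · exact (hu₂ hg₁.bddBelow).elim
  · exact (hu₁ hg₂.bddBelow).elim
  · rcases h₁ with ⟨b₁, hb₁, hy₁⟩ | ⟨hv₁, hy₁⟩ <;> rcases h₂ with ⟨b₂, hb₂, hy₂⟩ | ⟨hv₂, hy₂⟩
    · obtain rfl : b₁ = b₂ := hb₁.unique hb₂
      linarith
    · exact (hv₂ hb₁.bddAbove).elim
    · exact (hv₁ hb₂.bddAbove).elim
    · linarith

/-- The left-most interval of a nonempty finite union of intervals `X ⊆ ℝ` with `inf X = a ∈ ℝ`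
not attained: some `(a, c)`, `c > a`, lies in `X` (van den Dries 1998, Ch. 6, (1.1)(i): "then
`a < b` and `(a, b) ⊆ X`"; by constancy of the right germ of `X` at `a`, Ch. 1, (3.3)(ii)).
[cite: Dries1998, Ch. 6 §1 (1.1)(i), p. 93] -/
theorem exists_Ioo_sInf_subset {X : Set ℝ} (hX : IsFiniteUnionOfIntervals X) (hne : X.Nonempty)
    (hbdd : BddBelow X) (hnl : ¬ ∃ m, IsLeast X m) :
    ∃ c, sInf X < c ∧ Ioo (sInf X) c ⊆ X := by
  have ha : sInf X ∉ X := fun haX => hnl ⟨sInf X, haX, fun t ht => csInf_le hbdd ht⟩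
  obtain ⟨c, hac, hc | hc⟩ := hX.exists_Ioo_subset_or_disjoint_right (sInf X)
  · exact ⟨c, hac, hc⟩
  · exfalso
    have hcl : c ∈ lowerBounds X := fun x hx => by
      by_contra hxc
      have hax : sInf X < x := lt_of_le_of_ne (csInf_le hbdd hx) fun h => ha (h ▸ hx)
      exact disjoint_left.1 hc ⟨hax, lt_of_not_ge hxc⟩ hx
    exact absurd (le_csInf hne hcl) (not_le.2 hac)

/-- The left-most interval of a finite union of intervals `X ⊆ ℝ` that is unbounded below: some
ray `(-∞, c)` lies in `X` (van den Dries 1998, Ch. 6, (1.1)(i), case `a = -∞`; by finiteness of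
the boundary of `X`, Ch. 1, (3.3)(ii)). [cite: Dries1998, Ch. 6 §1 (1.1)(i), p. 93] -/
theorem exists_Iio_subset {X : Set ℝ} (hX : IsFiniteUnionOfIntervals X) (hbdd : ¬ BddBelow X) :
    ∃ c, Iio c ⊆ X := by
  obtain ⟨F, hF⟩ := hX.exists_finset_Ioo_subset_or_disjoint
  obtain ⟨l, hl⟩ := F.bddBelow
  rw [not_bddBelow_iff] at hbdd
  refine ⟨l - 1, fun s hs => ?_⟩
  obtain ⟨x, hxX, hxs⟩ := hbdd s
  have havoid : ∀ z ∈ F, z ∉ Ioo (x - 1) (l - 1) := fun z hz hzI => by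
    have hlz : l ≤ z := hl (Finset.mem_coe.2 hz)
    have := hzI.2
    linarith
  rcases hF (x - 1) (l - 1) havoid with h | h
  · exact h ⟨by linarith, hs⟩
  · exact absurd hxX (disjoint_left.1 h ⟨by linarith, by linarith [mem_Iio.1 hs]⟩)

/-- **`e(X)` is well defined**: for a nonempty finite union of points and intervals `X ⊆ ℝ` (in
particular for every nonempty definable subset of the line in an o-minimal expansion of
`(ℝ, <, +)`), the point `canonicalPt X` satisfies the first-order description `IsCanonicalPt X`
(van den Dries 1998, Ch. 6, (1.1)(i)). [cite: Dries1998, Ch. 6 §1 (1.1)(i), p. 93] -/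
theorem isCanonicalPt_canonicalPt {X : Set ℝ} (hX : IsFiniteUnionOfIntervals X)
    (hne : X.Nonempty) : IsCanonicalPt X (canonicalPt X) := by
  classical
  by_cases h1 : ∃ m, IsLeast X m
  · rw [canonicalPt, dif_pos h1]
    exact Or.inl h1.choose_spec
  by_cases h2 : BddBelow X
  · obtain ⟨c, hac, hc⟩ := exists_Ioo_sInf_subset hX hne h2 h1
    have hglb : IsGLB X (sInf X) := isGLB_csInf hne h2
    have hRne : ({t | sInf X < t ∧ Ioo (sInf X) t ⊆ X} : Set ℝ).Nonempty := ⟨c, hac, hc⟩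
    by_cases h3 : BddAbove {t | sInf X < t ∧ Ioo (sInf X) t ⊆ X}
    · rw [canonicalPt, dif_neg h1, if_pos h2, if_pos h3]
      exact Or.inr ⟨h1, Or.inl ⟨sInf X, hglb, Or.inl ⟨_, isLUB_csSup hRne h3, by ring⟩⟩⟩
    · rw [canonicalPt, dif_neg h1, if_pos h2, if_neg h3]
      exact Or.inr ⟨h1, Or.inl ⟨sInf X, hglb, Or.inr ⟨h3, rfl⟩⟩⟩
  · obtain ⟨c, hc⟩ := exists_Iio_subset hX h2
    have hRne : ({t | Iio t ⊆ X} : Set ℝ).Nonempty := ⟨c, hc⟩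
    by_cases h3 : BddAbove {t | Iio t ⊆ X}
    · rw [canonicalPt, dif_neg h1, if_neg h2, if_pos h3]
      exact Or.inr ⟨h1, Or.inr ⟨h2, Or.inl ⟨_, isLUB_csSup hRne h3, by ring⟩⟩⟩
    · rw [canonicalPt, dif_neg h1, if_neg h2, if_neg h3]
      exact Or.inr ⟨h1, Or.inr ⟨h2, Or.inr ⟨h3, rfl⟩⟩⟩

/-- `e(X) ∈ X` for every nonempty finite union of points and intervals `X ⊆ ℝ`
(van den Dries 1998, Ch. 6, (1.1)). [cite: Dries1998, Ch. 6 §1 (1.1)(i), p. 93] -/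
theorem canonicalPt_mem {X : Set ℝ} (hX : IsFiniteUnionOfIntervals X) (hne : X.Nonempty) :
    canonicalPt X ∈ X :=
  (isCanonicalPt_canonicalPt hX hne).mem

/-- For a nonempty finite union of points and intervals `X ⊆ ℝ`, the first-order condition
`IsCanonicalPt X y` says exactly `y = e(X)` (van den Dries 1998, Ch. 6, (1.1)(i)).
[cite: Dries1998, Ch. 6 §1 (1.1)(i), p. 93] -/
theorem eq_canonicalPt_iff {X : Set ℝ} (hX : IsFiniteUnionOfIntervals X) (hne : X.Nonempty)
    {y : ℝ} : y = canonicalPt X ↔ IsCanonicalPt X y :=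
  ⟨fun h => h ▸ isCanonicalPt_canonicalPt hX hne,
    fun h => h.unique (isCanonicalPt_canonicalPt hX hne)⟩

/-! ### Uniform first-order definability over the ordered field `ℝ` with parameters `A` -/

section Definability

variable {A : Set ℝ}

/-- The strict order of `ℝ` is definable in the language of ordered rings over any parameter set
(van den Dries 1998, Ch. 1, (3.2), (O1)). [cite: Dries1998, Ch. 1 (3.2)] -/
theorem definable_lt_real : A.Definable Language.orderedRing {v : Fin 2 → ℝ | v 0 < v 1} :=
  definable_lt_of_orderedStructure_params

/-- Atomic formulas: an equation between two terms of the language of ordered rings defines an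
`A`-definable set of tuples (no parameters are needed). [folklore] -/
theorem definable_setOf_termEq {γ : Type*} (t₁ t₂ : Language.orderedRing.Term γ) :
    A.Definable Language.orderedRing {u : γ → ℝ | t₁.realize u = t₂.realize u} := by
  refine Set.Definable.mono ?_ (empty_subset A)
  rw [Set.empty_definable_iff]
  exact ⟨t₁.equal t₂, by ext u; simp⟩

/-- **The fibre atom.** If `V ⊆ ℝ^(N+1)` is `A`-definable, then for definable coordinate
functions `w₁, …, w_N, t` of tuples `u`, the condition `(w u, t u) ∈ V` is `A`-definable in `u`
(inverse image of a definable set under a definable map, van den Dries 1998, Ch. 1, (2.3)(ii)).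
[cite: Dries1998, Ch. 1 (2.3)] -/
theorem definable_setOf_snoc_mem {N : ℕ} {V : Set (Fin (N + 1) → ℝ)}
    (hV : A.Definable Language.orderedRing V) {γ : Type*} {w : (γ → ℝ) → Fin N → ℝ}
    (hw : ∀ i, A.DefinableFun Language.orderedRing (fun u => w u i)) {t : (γ → ℝ) → ℝ}
    (ht : A.DefinableFun Language.orderedRing t) :
    A.Definable Language.orderedRing
      {u : γ → ℝ | (Fin.snoc (w u) (t u) : Fin (N + 1) → ℝ) ∈ V} := by
  have hF : A.DefinableMap Language.orderedRing
      (fun u : γ → ℝ => (Fin.snoc (w u) (t u) : Fin (N + 1) → ℝ)) := by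
    intro k
    refine Fin.lastCases ?_ (fun i => ?_) k
    · simpa only [Fin.snoc_last] using ht
    · simpa only [Fin.snoc_castSucc] using hw i
  exact hV.preimage_map hF

/-- **Uniformly definable families of subsets of the line.** A family `X u ⊆ ℝ` of subsets of the
line indexed by tuples `u : γ → ℝ` is *uniformly `A`-definable* if the condition `w k ∈ X (w ∘ σ)`
is an `A`-definable condition on tuples `w : δ → ℝ`, for every re-indexing `σ : γ → δ` of the
parameters and every coordinate `k : δ` — i.e. `y ∈ X_u` is given by a first-order formula
`φ(u, y)` with parameters from `A`, which may be substituted into (van den Dries 1998, Ch. 1,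
(5.1)–(5.3): definable families). This packaging lets nested quantifiers over `ℝ` compose.
[cite: Dries1998, Ch. 1 (5.1)] -/
def UDef (A : Set ℝ) {γ : Type} (X : (γ → ℝ) → Set ℝ) : Prop :=
  ∀ ⦃δ : Type⦄ (σ : γ → δ) (k : δ),
    A.Definable Language.orderedRing {w : δ → ℝ | w k ∈ X (fun i => w (σ i))}

/-- The fibres `V_w = {s | (w, s) ∈ V}` of an `A`-definable `V ⊆ ℝ^(N+1)` form a uniformly
`A`-definable family (van den Dries 1998, Ch. 1, (5.1)). [cite: Dries1998, Ch. 1 (5.1)] -/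
theorem udef_fibre {N : ℕ} {V : Set (Fin (N + 1) → ℝ)}
    (hV : A.Definable Language.orderedRing V) :
    UDef A (fun w : Fin N → ℝ => {s | (Fin.snoc w s : Fin (N + 1) → ℝ) ∈ V}) :=
  fun _ σ _ => definable_setOf_snoc_mem hV (w := fun u i => u (σ i))
    (fun _ => definableFun_proj_params _) (definableFun_proj_params _)

namespace UDef

variable {γ : Type} {X Y : (γ → ℝ) → Set ℝ}

/-- Re-indexing the parameters of a uniformly definable family gives a uniformly definable
family. [cite: Dries1998, Ch. 1 (5.1)] -/
theorem comp (hX : UDef A X) {δ : Type} (τ : γ → δ) :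
    UDef A (fun u : δ → ℝ => X (fun i => u (τ i))) :=
  fun _ σ k => hX (fun i => σ (τ i)) k

/-- Intersections of uniformly definable families are uniformly definable. [folklore] -/
theorem inter (hX : UDef A X) (hY : UDef A Y) : UDef A (fun u => X u ∩ Y u) :=
  fun _ σ k => (hX σ k).inter (hY σ k)

/-- Unions of uniformly definable families are uniformly definable. [folklore] -/
theorem union (hX : UDef A X) (hY : UDef A Y) : UDef A (fun u => X u ∪ Y u) :=
  fun _ σ k => (hX σ k).union (hY σ k)

/-- Complements of uniformly definable families are uniformly definable. [folklore] -/
theorem compl (hX : UDef A X) : UDef A (fun u => (X u)ᶜ) :=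
  fun _ σ k => (hX σ k).compl

/-- The (parameter-dependent, fibre-constant) condition "`X u` is nonempty" is uniformly
definable (`∃ y, y ∈ X_u`). [folklore] -/
theorem nonempty (hX : UDef A X) : UDef A (fun u => {_y | (X u).Nonempty}) := by
  intro δ σ k
  apply definable_setOf_exists_params
  exact hX (fun i => Sum.inl (σ i)) (Sum.inr ())

/-- The family of least elements `{m | IsLeast (X u) m}` of a uniformly definable family is
uniformly definable (`m ∈ X_u ∧ ∀ t, t ∈ X_u → m ≤ t`). [cite: Dries1998, Ch. 6 §1 (1.1)(i)] -/
theorem isLeast (hX : UDef A X) : UDef A (fun u => {m | IsLeast (X u) m}) := by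
  intro δ σ k
  refine definable_setOf_and_params (hX σ k) ?_
  apply definable_setOf_forall_params
  exact definable_setOf_imp_params (hX (fun i => Sum.inl (σ i)) (Sum.inr ()))
    (definable_setOf_le_params definable_lt_real (definableFun_proj_params _)
      (definableFun_proj_params _))

/-- The family of greatest lower bounds `{a | IsGLB (X u) a}` of a uniformly definable family is
uniformly definable. [cite: Dries1998, Ch. 6 §1 (1.1)(i)] -/
theorem isGLB (hX : UDef A X) : UDef A (fun u => {a | IsGLB (X u) a}) := by
  intro δ σ k
  refine definable_setOf_and_params ?_ ?_
  · apply definable_setOf_forall_params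
    exact definable_setOf_imp_params (hX (fun i => Sum.inl (σ i)) (Sum.inr ()))
      (definable_setOf_le_params definable_lt_real (definableFun_proj_params _)
        (definableFun_proj_params _))
  · apply definable_setOf_forall_params
    refine definable_setOf_imp_params ?_
      (definable_setOf_le_params definable_lt_real (definableFun_proj_params _)
        (definableFun_proj_params _))
    apply definable_setOf_forall_params
    exact definable_setOf_imp_params (hX (fun i => Sum.inl (Sum.inl (σ i))) (Sum.inr ()))
      (definable_setOf_le_params definable_lt_real (definableFun_proj_params _)
        (definableFun_proj_params _))

/-- The family of least upper bounds `{b | IsLUB (X u) b}` of a uniformly definable family is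
uniformly definable. [cite: Dries1998, Ch. 6 §1 (1.1)(i)] -/
theorem isLUB (hX : UDef A X) : UDef A (fun u => {b | IsLUB (X u) b}) := by
  intro δ σ k
  refine definable_setOf_and_params ?_ ?_
  · apply definable_setOf_forall_params
    exact definable_setOf_imp_params (hX (fun i => Sum.inl (σ i)) (Sum.inr ()))
      (definable_setOf_le_params definable_lt_real (definableFun_proj_params _)
        (definableFun_proj_params _))
  · apply definable_setOf_forall_params
    refine definable_setOf_imp_params ?_
      (definable_setOf_le_params definable_lt_real (definableFun_proj_params _)
        (definableFun_proj_params _))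
    apply definable_setOf_forall_params
    exact definable_setOf_imp_params (hX (fun i => Sum.inl (Sum.inl (σ i))) (Sum.inr ()))
      (definable_setOf_le_params definable_lt_real (definableFun_proj_params _)
        (definableFun_proj_params _))

/-- "`X u` is not bounded above" is a uniformly definable (fibre-constant) condition
(`∀ c, ∃ t ∈ X_u, c < t`). [cite: Dries1998, Ch. 6 §1 (1.1)(i)] -/
theorem not_bddAbove (hX : UDef A X) : UDef A (fun u => {_y | ¬ BddAbove (X u)}) := by
  intro δ σ k
  simp only [not_bddAbove_iff]
  apply definable_setOf_forall_params
  apply definable_setOf_exists_params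
  exact definable_setOf_and_params (hX (fun i => Sum.inl (Sum.inl (σ i))) (Sum.inr ()))
    (definable_setOf_lt_params definable_lt_real (definableFun_proj_params _)
      (definableFun_proj_params _))

/-- "`X u` is not bounded below" is a uniformly definable (fibre-constant) condition
(`∀ c, ∃ t ∈ X_u, t < c`). [cite: Dries1998, Ch. 6 §1 (1.1)(i)] -/
theorem not_bddBelow (hX : UDef A X) : UDef A (fun u => {_y | ¬ BddBelow (X u)}) := by
  intro δ σ k
  simp only [not_bddBelow_iff]
  apply definable_setOf_forall_params
  apply definable_setOf_exists_params
  exact definable_setOf_and_params (hX (fun i => Sum.inl (Sum.inl (σ i))) (Sum.inr ()))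
    (definable_setOf_lt_params definable_lt_real (definableFun_proj_params _)
      (definableFun_proj_params _))

/-- The family `{t | a < t ∧ (a, t) ⊆ X_u}` (whose supremum is the right end of the left-most
interval of `X_u`), the left end `a` being read off a coordinate `ka` of the parameters, is
uniformly definable. [cite: Dries1998, Ch. 6 §1 (1.1)(i)] -/
theorem reach (hX : UDef A X) (ka : γ) :
    UDef A (fun u => {t | u ka < t ∧ Ioo (u ka) t ⊆ X u}) := by
  intro δ σ k
  refine definable_setOf_and_params
    (definable_setOf_lt_params definable_lt_real (definableFun_proj_params _)
      (definableFun_proj_params _)) ?_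
  apply definable_setOf_forall_params
  refine definable_setOf_imp_params
    (definable_setOf_and_params
      (definable_setOf_lt_params definable_lt_real (definableFun_proj_params _)
        (definableFun_proj_params _))
      (definable_setOf_lt_params definable_lt_real (definableFun_proj_params _)
        (definableFun_proj_params _))) ?_
  exact hX (fun i => Sum.inl (σ i)) (Sum.inr ())

/-- The family `{t | (-∞, t) ⊆ X_u}` (whose supremum is the right end of the left-most interval
of an `X_u` unbounded below) is uniformly definable. [cite: Dries1998, Ch. 6 §1 (1.1)(i)] -/
theorem reachBot (hX : UDef A X) : UDef A (fun u => {t | Iio t ⊆ X u}) := by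
  intro δ σ k
  apply definable_setOf_forall_params
  exact definable_setOf_imp_params
    (definable_setOf_lt_params definable_lt_real (definableFun_proj_params _)
      (definableFun_proj_params _))
    (hX (fun i => Sum.inl (σ i)) (Sum.inr ()))

/-- **Definability of `e`** ("we can *definably* pick an element `e(X) ∈ X`", van den Dries
1998, Ch. 6, (1.1)): for a uniformly `A`-definable family `X_u ⊆ ℝ`, the graph condition
`y = e(X_u)`, in its first-order form `IsCanonicalPt (X u) y`, is uniformly `A`-definable — the
case distinction of (1.1)(i) only uses `<`, `+` and the constants `0, 1` of the language.
[cite: Dries1998, Ch. 6 §1 (1.1)(i), p. 93] -/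
theorem isCanonicalPt (hX : UDef A X) : UDef A (fun u => {y | IsCanonicalPt (X u) y}) := by
  intro δ σ k
  refine definable_setOf_or_params (hX.isLeast σ k) ?_
  refine definable_setOf_and_params (hX.isLeast.nonempty.compl σ k) ?_
  refine definable_setOf_or_params ?_ ?_
  · -- `a = inf X ∈ ℝ`: bind `a`
    apply definable_setOf_exists_params
    refine definable_setOf_and_params (hX.isGLB (fun i => Sum.inl (σ i)) (Sum.inr ())) ?_
    refine definable_setOf_or_params ?_ ?_
    · -- `b ∈ ℝ`: bind `b`; `y = (a + b) / 2`
      apply definable_setOf_exists_params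
      refine definable_setOf_and_params
        (((hX.comp fun i => Sum.inl (σ i)).reach (Sum.inr ())).isLUB Sum.inl (Sum.inr ())) ?_
      have h := definable_setOf_termEq (A := A)
        (Term.var (Sum.inl (Sum.inl k)) + Term.var (Sum.inl (Sum.inl k)) :
          Language.orderedRing.Term ((δ ⊕ Unit) ⊕ Unit))
        (Term.var (Sum.inl (Sum.inr ())) + Term.var (Sum.inr ()))
      simpa only [Language.orderedRing.realize_add, Term.realize_var] using h
    · -- `b = +∞`; `y = a + 1`
      refine definable_setOf_and_params
        (((hX.comp fun i => Sum.inl (σ i)).reach (Sum.inr ())).not_bddAbove (fun i => i)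
          (Sum.inr ())) ?_
      have h := definable_setOf_termEq (A := A)
        (Term.var (Sum.inl k) : Language.orderedRing.Term (δ ⊕ Unit))
        (Term.var (Sum.inr ()) + 1)
      simpa only [Language.orderedRing.realize_add, Language.orderedRing.realize_one,
        Term.realize_var] using h
  · -- `a = -∞`
    refine definable_setOf_and_params (hX.not_bddBelow σ k) ?_
    refine definable_setOf_or_params ?_ ?_
    · -- `b ∈ ℝ`: bind `b`; `y = b - 1`
      apply definable_setOf_exists_params
      refine definable_setOf_and_params
        (hX.reachBot.isLUB (fun i => Sum.inl (σ i)) (Sum.inr ())) ?_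
      have h := definable_setOf_termEq (A := A)
        (Term.var (Sum.inl k) + 1 : Language.orderedRing.Term (δ ⊕ Unit))
        (Term.var (Sum.inr ()))
      simpa only [Language.orderedRing.realize_add, Language.orderedRing.realize_one,
        Term.realize_var] using h
    · -- `b = +∞`; `y = 0`
      refine definable_setOf_and_params (hX.reachBot.not_bddAbove σ k) ?_
      have h := definable_setOf_termEq (A := A)
        (Term.var k : Language.orderedRing.Term δ) 0
      simpa only [Language.orderedRing.realize_zero, Term.realize_var] using h

end UDef

end Definability

/-! ### (1.2)(i) with `n = 1`: choice in the last coordinate -/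

open Literature.NumberTheory.Transcendental

/-- The fibres `V_w = {s | (w, s) ∈ V} ⊆ ℝ` of a `ℚ`-semialgebraic `V ⊆ ℝ^(N+1)` are finite unions
of points and intervals: they are definable with parameters `w` in the ordered field `ℝ`, which
is o-minimal (Tarski; `real_isOMinimal_holds`, van den Dries 1998, Ch. 2, (2.11)).
[cite: Dries1998, Ch. 2 (2.11)] -/
theorem isFiniteUnionOfIntervals_fibre {N : ℕ} {V : Set (Fin (N + 1) → ℝ)}
    (hV : IsSemialgebraic ℚ V) (w : Fin N → ℝ) :
    IsFiniteUnionOfIntervals {s : ℝ | (Fin.snoc w s : Fin (N + 1) → ℝ) ∈ V} := by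
  have hVu : (univ : Set ℝ).Definable Language.orderedRing V :=
    (definable_of_isSemialgebraic hV).mono (subset_univ _)
  refine real_isOMinimal_holds _ ?_
  exact definable_setOf_snoc_mem hVu (γ := Fin 1) (w := fun _ => w)
    (fun i => definableFun_const_params _ (mem_univ _)) (t := fun x => x 0)
    (definableFun_proj_params _)

/-- The projection `π V = {w | ∃ t, (w, t) ∈ V} ⊆ ℝ^N` of a `ℚ`-semialgebraic `V ⊆ ℝ^(N+1)` is
`ℚ`-semialgebraic (Tarski–Seidenberg, `tarski_seidenberg_real_holds`; Bochnak–Coste–Roy 1998,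
Thm. 2.2.1). [cite: BochnakCosteRoy1998, Thm. 2.2.1] -/
theorem isSemialgebraic_setOf_exists_snoc_mem {N : ℕ} {V : Set (Fin (N + 1) → ℝ)}
    (hV : IsSemialgebraic ℚ V) :
    IsSemialgebraic ℚ {w : Fin N → ℝ | ∃ t, (Fin.snoc w t : Fin (N + 1) → ℝ) ∈ V} := by
  refine (tarski_seidenberg_real_holds (k := ℚ) hV).of_forall_iff_mem fun w => ?_
  simp only [mem_image]
  constructor
  · rintro ⟨t, ht⟩
    exact ⟨_, ht, Fin.snoc_comp_castSucc⟩
  · rintro ⟨v, hv, rfl⟩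
    refine ⟨v (Fin.last N), ?_⟩
    have : (Fin.snoc (v ∘ Fin.castSucc) (v (Fin.last N)) : Fin (N + 1) → ℝ) = v :=
      Fin.snoc_init_self v
    rw [this]
    exact hv

/-- **van den Dries 1998, Ch. 6, (1.2)(i) for `n = 1`** (with parameters `w ∈ ℝ^N`): for a
`ℚ`-semialgebraic `V ⊆ ℝ^(N+1)` the map `h(w) := e(V_w)` (`e` the canonical point of (1.1)(i)) is
`ℚ`-semialgebraic on `π V = {w | V_w ≠ ∅}` — its graph is cut out by the first-order condition
`IsCanonicalPt`, definable over `ℚ` (`UDef.isCanonicalPt`) hence `ℚ`-semialgebraic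
(`definable_iff_isSemialgebraic_real`) — and `(w, h w) ∈ V` whenever `V_w ≠ ∅` ("define
`f(x) := e(S_x)` for `x ∈ π S`"). [cite: Dries1998, Ch. 6 §1 (1.2)(i), p. 94] -/
theorem exists_choice_last {N : ℕ} {V : Set (Fin (N + 1) → ℝ)} (hV : IsSemialgebraic ℚ V) :
    ∃ h : (Fin N → ℝ) → ℝ,
      IsSemialgebraicFunOn ℚ {w : Fin N → ℝ | ∃ t, (Fin.snoc w t : Fin (N + 1) → ℝ) ∈ V} h ∧
        ∀ (w : Fin N → ℝ) (t : ℝ), (Fin.snoc w t : Fin (N + 1) → ℝ) ∈ V →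
          (Fin.snoc w (h w) : Fin (N + 1) → ℝ) ∈ V := by
  have hX := udef_fibre (definable_of_isSemialgebraic hV)
  refine ⟨fun w => canonicalPt {s | (Fin.snoc w s : Fin (N + 1) → ℝ) ∈ V}, ?_, ?_⟩
  · rw [isSemialgebraicFunOn_iff]
    have hG := definable_setOf_and_params (hX.nonempty Fin.castSucc (Fin.last N))
      (hX.isCanonicalPt Fin.castSucc (Fin.last N))
    refine (isSemialgebraic_of_definable hG).of_forall_iff_mem fun z => ?_
    simp only [mem_setOf_eq]
    exact and_congr_right fun hne =>
      eq_canonicalPt_iff (isFiniteUnionOfIntervals_fibre hV _) hne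
  · intro w t ht
    exact canonicalPt_mem (isFiniteUnionOfIntervals_fibre hV w) ⟨t, ht⟩

/-! ### (1.2)(i): induction on `n` -/

/-- `Fin.append_snoc` with the dimension of the right-hand side spelled `p + q + 1`: Mathlib's
statement elaborates the implicit dimension of its right-hand side as `Nat.add p q`, which
`simp`/`rw` cannot match against `p + q` syntactically. [folklore] -/
theorem append_snoc' {α : Type*} {p q : ℕ} (x : Fin p → α) (y : Fin q → α) (t : α) :
    Fin.append x (Fin.snoc y t) = (Fin.snoc (Fin.append x y) t : Fin (p + q + 1) → α) :=
  Fin.append_snoc x y t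


/-- **van den Dries 1998, Ch. 6, Proposition (1.2)(i)** for `ℚ`-semialgebraic `V ⊆ ℝ^(p+q)`, by
induction on `q` as in (1.1)(ii) (`e(X) := (a, e(X_a))` with `a = e(π X)`): the case `q = 0` is
trivial; for `q + 1`, project `V` to `W = {w ∈ ℝ^(p+q) | ∃ t, (w, t) ∈ V}` (semialgebraic by
Tarski–Seidenberg), choose `g₀` for `W` by induction and the last coordinate by
`exists_choice_last`, and set `g x := (g₀ x, h (x, g₀ x))`; its graph over `π V` is the cylinder
over the graph of `g₀` cut with the graph of `h` over `W`.
[cite: Dries1998, Ch. 6 §1 (1.1)(ii) and (1.2)(i), p. 93–94] -/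
theorem exists_choice : ∀ (q p : ℕ) (V : Set (Fin (p + q) → ℝ)), IsSemialgebraic ℚ V →
    ∃ g : (Fin p → ℝ) → (Fin q → ℝ),
      IsSemialgebraicMapOn ℚ {x | ∃ y, Fin.append x y ∈ V} g ∧
        ∀ (x : Fin p → ℝ) (y : Fin q → ℝ), Fin.append x y ∈ V → Fin.append x (g x) ∈ V
  | 0, p, V, hV => by
    refine ⟨fun _ => Fin.elim0, ?_, fun x y hxy => ?_⟩
    · refine hV.of_forall_iff_mem fun z => ?_
      constructor
      · rintro ⟨x, ⟨y, hy⟩, rfl⟩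
        rw [Fin.append_right_nil _ _ rfl] at hy ⊢
        exact hy
      · intro hz
        refine ⟨fun i => z (Fin.castAdd 0 i), ⟨fun i => z (Fin.natAdd p i), ?_⟩, ?_⟩
        · rw [Fin.append_castAdd_natAdd]
          exact hz
        · rw [Fin.append_right_nil _ _ rfl]
          funext i
          exact congrArg z (Fin.ext rfl)
    · rw [Fin.append_right_nil _ _ rfl] at hxy ⊢
      exact hxy
  | q + 1, p, V, hV => by
    -- `V ⊆ ℝ^(p+(q+1)) = ℝ^((p+q)+1)`; its projection `W ⊆ ℝ^(p+q)` forgetting the last coordinate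
    have hV' : IsSemialgebraic (ι := Fin (p + q + 1)) ℚ V := hV
    have hW := isSemialgebraic_setOf_exists_snoc_mem (N := p + q) hV'
    obtain ⟨h, hh, hhV⟩ := exists_choice_last (N := p + q) hV'
    obtain ⟨g₀, hg₀, hg₀W⟩ := exists_choice q p _ hW
    refine ⟨fun x => Fin.snoc (g₀ x) (h (Fin.append x (g₀ x))), ?_, fun x y hxy => ?_⟩
    · -- graph of `g` over `π V` = cylinder over the graph of `g₀` ∩ graph of `h` over `W`
      have h1 := IsSemialgebraic.setOf_init_mem hg₀
      have h2 := isSemialgebraicFunOn_iff.mp hh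
      refine (h1.inter h2).of_forall_iff_mem fun z => ?_
      simp only [mem_inter_iff, mem_setOf_eq]
      constructor
      · rintro ⟨x, ⟨y, hy⟩, rfl⟩
        have hyW : ∃ t, (Fin.snoc (Fin.append x (Fin.init y)) t : Fin (p + q + 1) → ℝ) ∈ V :=
          ⟨y (Fin.last q), by rw [← append_snoc', Fin.snoc_init_self]; exact hy⟩
        have hxW := hg₀W x _ hyW
        simp only [append_snoc', Fin.init_snoc, Fin.snoc_last]
        exact ⟨⟨x, ⟨_, hyW⟩, rfl⟩, hxW, trivial⟩
      · rintro ⟨⟨x, ⟨y', t, ht⟩, hzx⟩, -, hz⟩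
        refine ⟨x, ⟨Fin.snoc y' t, by rw [append_snoc']; exact ht⟩, ?_⟩
        rw [append_snoc', ← hzx, ← hz, Fin.snoc_init_self]
    · have hy : (Fin.snoc (Fin.append x (Fin.init y)) (y (Fin.last q)) : Fin (p + q + 1) → ℝ)
          ∈ V := by
        rw [← append_snoc', Fin.snoc_init_self]; exact hxy
      obtain ⟨t, ht⟩ := hg₀W x (Fin.init y) ⟨_, hy⟩
      have := hhV _ t ht
      beta_reduce
      rw [append_snoc']
      exact this

end DefinableChoice

/-- **van den Dries 1998, Ch. 6, Proposition (1.2)(i) — Definable Choice** for parameter-free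
(`ℚ`-)semialgebraic sets: discharge of the named fact
`Literature.ModelTheory.ExponentialFields.vandenDries1998_ch6_prop_1_2_i`. Proved as printed:
"PROOF. For (i), define `f(x) := e(S_x)` for `x ∈ π S`", `e` being the canonical point of
(1.1) (`DefinableChoice.canonicalPt`, coordinate by coordinate: `DefinableChoice.exists_choice`);
definability of `f` over `ℚ` is `DefinableChoice.UDef.isCanonicalPt` combined with
"definable over `ℚ` = `ℚ`-semialgebraic" (`definable_iff_isSemialgebraic_real_holds`), and
`e(S_x) ∈ S_x` uses that the fibres are finite unions of intervals (o-minimality of `ℝ`,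
`real_isOMinimal_holds`). [cite: Dries1998, Ch. 6 §1 Proposition (1.2)(i), p. 94] -/
theorem vandenDries1998_ch6_prop_1_2_i_holds : vandenDries1998_ch6_prop_1_2_i := by
  intro p q V hV
  exact DefinableChoice.exists_choice q p V hV

end Literature.ModelTheory.ExponentialFields
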